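import Summits.Ventures.YMGap.Thresholds.PolyFluxField
import Summits.QuantumFields.BalabanUV.InfraRed.StrongCouplingFluxMoments
import HarnessLib

/-!
# Venture YMGap, track (a) / A4 kernel port, Stage 2 — ball-moment expansions of the divergence form `H` and the size form `Q`
# for the polynomial-profile flux field (engine-2's spec `HOME/pub-ymgap-engine-2/PolyFluxMomentsSpec.lean`)

HONEST FRAMING: venture file of the cell `pub-ymgap` (QuantumFields programme); the `FluxMoments` analogue for the polynomial-profile field of
`PolyFluxField` (PLAN R78 Stage 2, rung 2/3).  Pure [folklore] calculus/measure bookkeeping, kernel-proved; NO certificate, NO number, NO covariance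
bound or threshold is claimed here.  Statements (1) `H_expand_poly` and (2) `Q_expand_poly` are EXACTLY engine-2's spec (the piece generator and
`flux_bound4` match them syntactically); the generic tool is `ball_monomial_sum₂`:
`∫₀¹ rᵃ ∫ e^{κrx₀} (Σ_{k<n} c_k (rx₀)^k + r² Σ_{k<n} e_k (rx₀)^k) dσ dr = Σ_k c_k J(k, a+k) + Σ_k e_k J(k, a+2+k)`,
`J(l, m) = ∫₀¹ r^m ∫ x₀^l e^{κrx₀} dσ dr`.  The transverse cross term of `‖V‖²` dies by leaf (19)'s reflection symmetry.  NOT CLAIMED: any number.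
-/

noncomputable section

open MeasureTheory Filter Finset Real
open scoped NNReal Quaternion Matrix ComplexConjugate BigOperators Matrix.Norms.Frobenius ContDiff Topology
  RealInnerProductSpace
open Matrix Complex
open Literature.MathematicalPhysics.QuantumLattice (su2Quat quatMatrix quatMatrix_mul quatMatrix_su2Quat norm_su2Quat)
open Literature.MathematicalPhysics.QuantumFieldTheory
open Literature.MathematicalPhysics.QuantumFieldTheory.SUNBakryEmery
open Summit.Ventures.YMGap.PolyFluxField

namespace Summit.Ventures.YMGap.PolyFluxMoments

open Summit.QuantumFields.BalabanUV.InfraRed.StrongCouplingSphereCalculus (quatOfMat quatOfMat_coe)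
open Summit.QuantumFields.BalabanUV.InfraRed.StrongCouplingFluxMoments (continuous_integral₂)
open Summit.QuantumFields.BalabanUV.InfraRed.StrongCouplingFluxField (integral_inner_mul_eq_zero)

/-! ## 0. Continuity plumbing (private copies) -/

/-- Continuity of `su2Quat`. [folklore] -/
private theorem cq1 : Continuous fun g : Matrix.specialUnitaryGroup (Fin 2) ℂ => su2Quat g := by
  have h : Continuous fun g : Matrix.specialUnitaryGroup (Fin 2) ℂ => quatOfMat (g : Matrix (Fin 2) (Fin 2) ℂ) :=
    (LinearMap.continuous_of_finiteDimensional quatOfMat).comp continuous_subtype_val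
  simpa only [quatOfMat_coe] using h

/-- Continuity of the coordinate `x₀`. [folklore] -/
private theorem cq2 : Continuous fun g : Matrix.specialUnitaryGroup (Fin 2) ℂ => (su2Quat g).re :=
  Quaternion.continuous_re.comp cq1

/-- Joint continuity plumbing: `(r, g) ↦ (x_g)₀`. [folklore] -/
private theorem cp2 : Continuous fun p : ℝ × Matrix.specialUnitaryGroup (Fin 2) ℂ => (su2Quat p.2).re :=
  cq2.comp continuous_snd

/-! ## 1. The generic monomial expansion -/

/-- **Monomial expansion of a ball integral.**  For coefficient sequences `c, e` and `n : ℕ`: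
`∫₀¹ rᵃ ∫ e^{κrx₀} (Σ_{k<n} c_k (rx₀)^k + r²·Σ_{k<n} e_k (rx₀)^k) dσ dr = Σ_{k<n} c_k J(k, a+k) + Σ_{k<n} e_k J(k, a+2+k)` with
`J(l, m) = ∫₀¹ r^m ∫ x₀^l e^{κrx₀} dσ dr`. [folklore] -/
theorem ball_monomial_sum₂ (κ : ℝ) (a n : ℕ) (c e : ℕ → ℝ) :
    ∫ r in (0:ℝ)..1, r ^ a * ∫ g : Matrix.specialUnitaryGroup (Fin 2) ℂ, Real.exp (κ * r * (su2Quat g).re) *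
        ((∑ k ∈ Finset.range n, c k * (r * (su2Quat g).re) ^ k) + r ^ 2 * ∑ k ∈ Finset.range n, e k * (r * (su2Quat g).re) ^ k)
        ∂(haarProbability (Matrix.specialUnitaryGroup (Fin 2) ℂ)) =
      (∑ k ∈ Finset.range n, c k * ∫ r in (0:ℝ)..1, r ^ (a + k) * ∫ g : Matrix.specialUnitaryGroup (Fin 2) ℂ,
          (su2Quat g).re ^ k * Real.exp (κ * r * (su2Quat g).re) ∂(haarProbability (Matrix.specialUnitaryGroup (Fin 2) ℂ))) +
      ∑ k ∈ Finset.range n, e k * ∫ r in (0:ℝ)..1, r ^ (a + 2 + k) * ∫ g : Matrix.specialUnitaryGroup (Fin 2) ℂ,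
          (su2Quat g).re ^ k * Real.exp (κ * r * (su2Quat g).re) ∂(haarProbability (Matrix.specialUnitaryGroup (Fin 2) ℂ)) := by
  have hq := cq2
  have hp := cp2
  set μ := haarProbability (Matrix.specialUnitaryGroup (Fin 2) ℂ) with hμ
  -- the k-th moment as a continuous function of r
  have cI : ∀ k : ℕ, Continuous fun r : ℝ => ∫ g, (su2Quat g).re ^ k * Real.exp (κ * r * (su2Quat g).re) ∂μ := fun k =>
    continuous_integral₂ (F := fun r g => (su2Quat g).re ^ k * Real.exp (κ * r * (su2Quat g).re)) (by fun_prop)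
  -- pointwise rewriting of the integrand
  have hpt : ∀ (r : ℝ) (g : Matrix.specialUnitaryGroup (Fin 2) ℂ), r ^ a * (Real.exp (κ * r * (su2Quat g).re) *
      ((∑ k ∈ Finset.range n, c k * (r * (su2Quat g).re) ^ k) + r ^ 2 * ∑ k ∈ Finset.range n, e k * (r * (su2Quat g).re) ^ k)) =
      ∑ k ∈ Finset.range n, (c k * r ^ (a + k) + e k * r ^ (a + 2 + k)) * ((su2Quat g).re ^ k * Real.exp (κ * r * (su2Quat g).re)) := by
    intro r g
    rw [Finset.mul_sum, ← Finset.sum_add_distrib, Finset.mul_sum, Finset.mul_sum]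
    refine Finset.sum_congr rfl fun k _ => ?_
    rw [mul_pow, pow_add, pow_add, pow_add]
    ring
  -- inner integral for each r
  have inner : ∀ r : ℝ, r ^ a * ∫ g, Real.exp (κ * r * (su2Quat g).re) *
      ((∑ k ∈ Finset.range n, c k * (r * (su2Quat g).re) ^ k) + r ^ 2 * ∑ k ∈ Finset.range n, e k * (r * (su2Quat g).re) ^ k) ∂μ =
      ∑ k ∈ Finset.range n, (c k * r ^ (a + k) + e k * r ^ (a + 2 + k)) *
        ∫ g, (su2Quat g).re ^ k * Real.exp (κ * r * (su2Quat g).re) ∂μ := by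
    intro r
    rw [← integral_const_mul]
    simp_rw [hpt r]
    have hint : ∀ k ∈ Finset.range n, Integrable (fun g : Matrix.specialUnitaryGroup (Fin 2) ℂ =>
        (c k * r ^ (a + k) + e k * r ^ (a + 2 + k)) * ((su2Quat g).re ^ k * Real.exp (κ * r * (su2Quat g).re))) μ :=
      fun k _ => integrable_of_continuous_SUN (by fun_prop) μ
    rw [integral_finsetSum _ hint]
    refine Finset.sum_congr rfl fun k _ => ?_
    rw [integral_const_mul]
  rw [intervalIntegral.integral_congr (fun r _ => inner r)]
  have hint : ∀ k ∈ Finset.range n, IntervalIntegrable (fun r : ℝ => (c k * r ^ (a + k) + e k * r ^ (a + 2 + k)) *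
      ∫ g, (su2Quat g).re ^ k * Real.exp (κ * r * (su2Quat g).re) ∂μ) volume 0 1 := fun k _ =>
    (((continuous_const.mul (continuous_pow _)).add (continuous_const.mul (continuous_pow _))).mul (cI k)).intervalIntegrable 0 1
  rw [intervalIntegral.integral_finsetSum hint]
  rw [← Finset.sum_add_distrib]
  refine Finset.sum_congr rfl fun k _ => ?_
  have i1 : IntervalIntegrable (fun r : ℝ => c k * (r ^ (a + k) * ∫ g, (su2Quat g).re ^ k * Real.exp (κ * r * (su2Quat g).re) ∂μ))
      volume 0 1 := (continuous_const.mul ((continuous_pow _).mul (cI k))).intervalIntegrable 0 1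
  have i2 : IntervalIntegrable (fun r : ℝ => e k * (r ^ (a + 2 + k) * ∫ g, (su2Quat g).re ^ k * Real.exp (κ * r * (su2Quat g).re) ∂μ))
      volume 0 1 := (continuous_const.mul ((continuous_pow _).mul (cI k))).intervalIntegrable 0 1
  rw [← intervalIntegral.integral_const_mul, ← intervalIntegral.integral_const_mul, ← intervalIntegral.integral_add i1 i2]
  refine intervalIntegral.integral_congr fun r _ => ?_
  ring

/-! ## 2. The two expansions of engine-2's spec -/

/-- **Expansion of the divergence form.** For the degree-4 divergence polynomial `φ(t) = h₀ + h₁t + h₂t² + h₃t³ + h₄t⁴`: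
`∫₀¹ r³ ∫ e^{κrx₀} φ(rx₀)² dσ dr = Σ_{i,j} hᵢhⱼ J(i+j, 3+i+j)`. [folklore] -/
theorem H_expand_poly (κ h₀ h₁ h₂ h₃ h₄ : ℝ) :
    ∫ r in (0:ℝ)..1, r ^ 3 * ∫ g : Matrix.specialUnitaryGroup (Fin 2) ℂ, Real.exp (κ * r * (su2Quat g).re) *
        (h₀ + h₁ * (r * (su2Quat g).re) + h₂ * (r * (su2Quat g).re) ^ 2 + h₃ * (r * (su2Quat g).re) ^ 3 + h₄ * (r * (su2Quat g).re) ^ 4) ^ 2 ∂(haarProbability (Matrix.specialUnitaryGroup (Fin 2) ℂ)) =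
      h₀ ^ 2 * (∫ r in (0:ℝ)..1, r ^ 3 * ∫ g : Matrix.specialUnitaryGroup (Fin 2) ℂ, Real.exp (κ * r * (su2Quat g).re) ∂(haarProbability (Matrix.specialUnitaryGroup (Fin 2) ℂ)))
      + 2 * h₀ * h₁ * (∫ r in (0:ℝ)..1, r ^ 4 * ∫ g : Matrix.specialUnitaryGroup (Fin 2) ℂ, (su2Quat g).re * Real.exp (κ * r * (su2Quat g).re) ∂(haarProbability (Matrix.specialUnitaryGroup (Fin 2) ℂ)))
      + (h₁ ^ 2 + 2 * h₀ * h₂) * (∫ r in (0:ℝ)..1, r ^ 5 * ∫ g : Matrix.specialUnitaryGroup (Fin 2) ℂ, (su2Quat g).re ^ 2 * Real.exp (κ * r * (su2Quat g).re) ∂(haarProbability (Matrix.specialUnitaryGroup (Fin 2) ℂ)))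
      + (2 * h₀ * h₃ + 2 * h₁ * h₂) * (∫ r in (0:ℝ)..1, r ^ 6 * ∫ g : Matrix.specialUnitaryGroup (Fin 2) ℂ, (su2Quat g).re ^ 3 * Real.exp (κ * r * (su2Quat g).re) ∂(haarProbability (Matrix.specialUnitaryGroup (Fin 2) ℂ)))
      + (h₂ ^ 2 + 2 * h₀ * h₄ + 2 * h₁ * h₃) * (∫ r in (0:ℝ)..1, r ^ 7 * ∫ g : Matrix.specialUnitaryGroup (Fin 2) ℂ, (su2Quat g).re ^ 4 * Real.exp (κ * r * (su2Quat g).re) ∂(haarProbability (Matrix.specialUnitaryGroup (Fin 2) ℂ)))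
      + (2 * h₁ * h₄ + 2 * h₂ * h₃) * (∫ r in (0:ℝ)..1, r ^ 8 * ∫ g : Matrix.specialUnitaryGroup (Fin 2) ℂ, (su2Quat g).re ^ 5 * Real.exp (κ * r * (su2Quat g).re) ∂(haarProbability (Matrix.specialUnitaryGroup (Fin 2) ℂ)))
      + (h₃ ^ 2 + 2 * h₂ * h₄) * (∫ r in (0:ℝ)..1, r ^ 9 * ∫ g : Matrix.specialUnitaryGroup (Fin 2) ℂ, (su2Quat g).re ^ 6 * Real.exp (κ * r * (su2Quat g).re) ∂(haarProbability (Matrix.specialUnitaryGroup (Fin 2) ℂ)))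
      + 2 * h₃ * h₄ * (∫ r in (0:ℝ)..1, r ^ 10 * ∫ g : Matrix.specialUnitaryGroup (Fin 2) ℂ, (su2Quat g).re ^ 7 * Real.exp (κ * r * (su2Quat g).re) ∂(haarProbability (Matrix.specialUnitaryGroup (Fin 2) ℂ)))
      + h₄ ^ 2 * (∫ r in (0:ℝ)..1, r ^ 11 * ∫ g : Matrix.specialUnitaryGroup (Fin 2) ℂ, (su2Quat g).re ^ 8 * Real.exp (κ * r * (su2Quat g).re) ∂(haarProbability (Matrix.specialUnitaryGroup (Fin 2) ℂ))) := by
  set c : ℕ → ℝ := fun k => [h₀ ^ 2, 2 * h₀ * h₁, h₁ ^ 2 + 2 * h₀ * h₂, 2 * h₀ * h₃ + 2 * h₁ * h₂,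
    h₂ ^ 2 + 2 * h₀ * h₄ + 2 * h₁ * h₃, 2 * h₁ * h₄ + 2 * h₂ * h₃, h₃ ^ 2 + 2 * h₂ * h₄, 2 * h₃ * h₄, h₄ ^ 2].getD k 0 with hc
  have key := ball_monomial_sum₂ κ 3 9 c (fun _ => 0)
  have hpt : ∀ (r : ℝ) (g : Matrix.specialUnitaryGroup (Fin 2) ℂ), Real.exp (κ * r * (su2Quat g).re) *
      (h₀ + h₁ * (r * (su2Quat g).re) + h₂ * (r * (su2Quat g).re) ^ 2 + h₃ * (r * (su2Quat g).re) ^ 3 + h₄ * (r * (su2Quat g).re) ^ 4) ^ 2 =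
      Real.exp (κ * r * (su2Quat g).re) *
        ((∑ k ∈ Finset.range 9, c k * (r * (su2Quat g).re) ^ k) + r ^ 2 * ∑ k ∈ Finset.range 9, (fun _ : ℕ => (0:ℝ)) k * (r * (su2Quat g).re) ^ k) := by
    intro r g
    simp only [hc, Finset.sum_range_succ, Finset.sum_range_zero, List.getD_cons_zero, List.getD_cons_succ, zero_mul, add_zero,
      Finset.sum_const_zero, mul_zero]
    ring
  have hL : (∫ r in (0:ℝ)..1, r ^ 3 * ∫ g : Matrix.specialUnitaryGroup (Fin 2) ℂ, Real.exp (κ * r * (su2Quat g).re) *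
        (h₀ + h₁ * (r * (su2Quat g).re) + h₂ * (r * (su2Quat g).re) ^ 2 + h₃ * (r * (su2Quat g).re) ^ 3 + h₄ * (r * (su2Quat g).re) ^ 4) ^ 2
        ∂(haarProbability (Matrix.specialUnitaryGroup (Fin 2) ℂ))) =
      ∫ r in (0:ℝ)..1, r ^ 3 * ∫ g : Matrix.specialUnitaryGroup (Fin 2) ℂ, Real.exp (κ * r * (su2Quat g).re) *
        ((∑ k ∈ Finset.range 9, c k * (r * (su2Quat g).re) ^ k) + r ^ 2 * ∑ k ∈ Finset.range 9, (fun _ : ℕ => (0:ℝ)) k * (r * (su2Quat g).re) ^ k)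
        ∂(haarProbability (Matrix.specialUnitaryGroup (Fin 2) ℂ)) := by
    refine intervalIntegral.integral_congr fun r _ => ?_
    congr 1
    exact integral_congr_ae (ae_of_all _ fun g => hpt r g)
  rw [hL, key]
  simp only [hc, Finset.sum_range_succ, Finset.sum_range_zero, List.getD_cons_zero, List.getD_cons_succ, zero_mul, add_zero,
    zero_add, pow_zero, pow_one, one_mul]

/-- **Expansion of the size form** for a transverse `d′` (`Re d′ = 0`), a quadratic `P` and a cubic `Q`:
`∫₀¹ r³ ∫ e^{κrx₀} ‖V(rx)‖² dσ dr = ‖d′‖² z_B + p²(Σ_s α_s J(s,3+s) + Σ_s γ_s J(s,5+s))`, where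
`P(t)² + 2tP(t)Q(t) = Σ α_s t^s`, `Q(t)² = Σ γ_s t^s` (`‖V(rx)‖² = ‖d′‖² + 2pQ⟪d′,rx⟫ + p²(P² + 2(rx₀)PQ + r²Q²)` at `t = rx₀`,
`norm_profileField_sq`; the `⟪d′, x⟫` term dies by `integral_inner_mul_eq_zero`). [folklore] -/
theorem Q_expand_poly (κ p a₀ a₁ a₂ q₀ q₁ q₂ q₃ : ℝ) {d' : ℍ} (hd' : d'.re = 0) {P Q : ℝ → ℝ}
    (hP : ∀ t, P t = a₀ + a₁ * t + a₂ * t ^ 2) (hQ : ∀ t, Q t = q₀ + q₁ * t + q₂ * t ^ 2 + q₃ * t ^ 3) :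
    ∫ r in (0:ℝ)..1, r ^ 3 * ∫ g : Matrix.specialUnitaryGroup (Fin 2) ℂ, Real.exp (κ * r * (su2Quat g).re) *
        ‖profileField d' p P Q (r • su2Quat g)‖ ^ 2 ∂(haarProbability (Matrix.specialUnitaryGroup (Fin 2) ℂ)) =
      ‖d'‖ ^ 2 * (∫ r in (0:ℝ)..1, r ^ 3 * ∫ g : Matrix.specialUnitaryGroup (Fin 2) ℂ, Real.exp (κ * r * (su2Quat g).re) ∂(haarProbability (Matrix.specialUnitaryGroup (Fin 2) ℂ)))
      + p ^ 2 * (a₀ ^ 2 * (∫ r in (0:ℝ)..1, r ^ 3 * ∫ g : Matrix.specialUnitaryGroup (Fin 2) ℂ, Real.exp (κ * r * (su2Quat g).re) ∂(haarProbability (Matrix.specialUnitaryGroup (Fin 2) ℂ)))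
        + (2 * a₀ * a₁ + 2 * a₀ * q₀) * (∫ r in (0:ℝ)..1, r ^ 4 * ∫ g : Matrix.specialUnitaryGroup (Fin 2) ℂ, (su2Quat g).re * Real.exp (κ * r * (su2Quat g).re) ∂(haarProbability (Matrix.specialUnitaryGroup (Fin 2) ℂ)))
        + (a₁ ^ 2 + 2 * a₀ * a₂ + 2 * (a₀ * q₁ + a₁ * q₀)) * (∫ r in (0:ℝ)..1, r ^ 5 * ∫ g : Matrix.specialUnitaryGroup (Fin 2) ℂ, (su2Quat g).re ^ 2 * Real.exp (κ * r * (su2Quat g).re) ∂(haarProbability (Matrix.specialUnitaryGroup (Fin 2) ℂ)))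
        + (2 * a₁ * a₂ + 2 * (a₀ * q₂ + a₁ * q₁ + a₂ * q₀)) * (∫ r in (0:ℝ)..1, r ^ 6 * ∫ g : Matrix.specialUnitaryGroup (Fin 2) ℂ, (su2Quat g).re ^ 3 * Real.exp (κ * r * (su2Quat g).re) ∂(haarProbability (Matrix.specialUnitaryGroup (Fin 2) ℂ)))
        + (a₂ ^ 2 + 2 * (a₀ * q₃ + a₁ * q₂ + a₂ * q₁)) * (∫ r in (0:ℝ)..1, r ^ 7 * ∫ g : Matrix.specialUnitaryGroup (Fin 2) ℂ, (su2Quat g).re ^ 4 * Real.exp (κ * r * (su2Quat g).re) ∂(haarProbability (Matrix.specialUnitaryGroup (Fin 2) ℂ)))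
        + (2 * (a₁ * q₃ + a₂ * q₂)) * (∫ r in (0:ℝ)..1, r ^ 8 * ∫ g : Matrix.specialUnitaryGroup (Fin 2) ℂ, (su2Quat g).re ^ 5 * Real.exp (κ * r * (su2Quat g).re) ∂(haarProbability (Matrix.specialUnitaryGroup (Fin 2) ℂ)))
        + (2 * a₂ * q₃) * (∫ r in (0:ℝ)..1, r ^ 9 * ∫ g : Matrix.specialUnitaryGroup (Fin 2) ℂ, (su2Quat g).re ^ 6 * Real.exp (κ * r * (su2Quat g).re) ∂(haarProbability (Matrix.specialUnitaryGroup (Fin 2) ℂ)))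
        + q₀ ^ 2 * (∫ r in (0:ℝ)..1, r ^ 5 * ∫ g : Matrix.specialUnitaryGroup (Fin 2) ℂ, Real.exp (κ * r * (su2Quat g).re) ∂(haarProbability (Matrix.specialUnitaryGroup (Fin 2) ℂ)))
        + (2 * q₀ * q₁) * (∫ r in (0:ℝ)..1, r ^ 6 * ∫ g : Matrix.specialUnitaryGroup (Fin 2) ℂ, (su2Quat g).re * Real.exp (κ * r * (su2Quat g).re) ∂(haarProbability (Matrix.specialUnitaryGroup (Fin 2) ℂ)))
        + (q₁ ^ 2 + 2 * q₀ * q₂) * (∫ r in (0:ℝ)..1, r ^ 7 * ∫ g : Matrix.specialUnitaryGroup (Fin 2) ℂ, (su2Quat g).re ^ 2 * Real.exp (κ * r * (su2Quat g).re) ∂(haarProbability (Matrix.specialUnitaryGroup (Fin 2) ℂ)))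
        + (2 * q₀ * q₃ + 2 * q₁ * q₂) * (∫ r in (0:ℝ)..1, r ^ 8 * ∫ g : Matrix.specialUnitaryGroup (Fin 2) ℂ, (su2Quat g).re ^ 3 * Real.exp (κ * r * (su2Quat g).re) ∂(haarProbability (Matrix.specialUnitaryGroup (Fin 2) ℂ)))
        + (q₂ ^ 2 + 2 * q₁ * q₃) * (∫ r in (0:ℝ)..1, r ^ 9 * ∫ g : Matrix.specialUnitaryGroup (Fin 2) ℂ, (su2Quat g).re ^ 4 * Real.exp (κ * r * (su2Quat g).re) ∂(haarProbability (Matrix.specialUnitaryGroup (Fin 2) ℂ)))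
        + (2 * q₂ * q₃) * (∫ r in (0:ℝ)..1, r ^ 10 * ∫ g : Matrix.specialUnitaryGroup (Fin 2) ℂ, (su2Quat g).re ^ 5 * Real.exp (κ * r * (su2Quat g).re) ∂(haarProbability (Matrix.specialUnitaryGroup (Fin 2) ℂ)))
        + q₃ ^ 2 * (∫ r in (0:ℝ)..1, r ^ 11 * ∫ g : Matrix.specialUnitaryGroup (Fin 2) ℂ, (su2Quat g).re ^ 6 * Real.exp (κ * r * (su2Quat g).re) ∂(haarProbability (Matrix.specialUnitaryGroup (Fin 2) ℂ)))) := by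
  have hq1 := cq1
  have hq := cq2
  set μ := haarProbability (Matrix.specialUnitaryGroup (Fin 2) ℂ) with hμ
  -- coefficient lists of  ‖d′‖² + p²(P² + 2tPQ)  and  p² Q²  as polynomials in t
  set c : ℕ → ℝ := fun k => [‖d'‖ ^ 2 + p ^ 2 * a₀ ^ 2, p ^ 2 * (2 * a₀ * a₁ + 2 * a₀ * q₀),
    p ^ 2 * (a₁ ^ 2 + 2 * a₀ * a₂ + 2 * (a₀ * q₁ + a₁ * q₀)), p ^ 2 * (2 * a₁ * a₂ + 2 * (a₀ * q₂ + a₁ * q₁ + a₂ * q₀)),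
    p ^ 2 * (a₂ ^ 2 + 2 * (a₀ * q₃ + a₁ * q₂ + a₂ * q₁)), p ^ 2 * (2 * (a₁ * q₃ + a₂ * q₂)), p ^ 2 * (2 * a₂ * q₃)].getD k 0 with hc
  set e : ℕ → ℝ := fun k => [p ^ 2 * q₀ ^ 2, p ^ 2 * (2 * q₀ * q₁), p ^ 2 * (q₁ ^ 2 + 2 * q₀ * q₂), p ^ 2 * (2 * q₀ * q₃ + 2 * q₁ * q₂),
    p ^ 2 * (q₂ ^ 2 + 2 * q₁ * q₃), p ^ 2 * (2 * q₂ * q₃), p ^ 2 * q₃ ^ 2].getD k 0 with he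
  have key := ball_monomial_sum₂ κ 3 7 c e
  -- pointwise: the integrand = exp·(Σ c_k t^k + r² Σ e_k t^k) + ⟪d′, x⟫·G(r, x₀)
  have hpt : ∀ (r : ℝ) (g : Matrix.specialUnitaryGroup (Fin 2) ℂ),
      Real.exp (κ * r * (su2Quat g).re) * ‖profileField d' p P Q (r • su2Quat g)‖ ^ 2 =
        Real.exp (κ * r * (su2Quat g).re) *
          ((∑ k ∈ Finset.range 7, c k * (r * (su2Quat g).re) ^ k) + r ^ 2 * ∑ k ∈ Finset.range 7, e k * (r * (su2Quat g).re) ^ k) +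
        ⟪d', su2Quat g⟫ * (2 * p * r * Q (r * (su2Quat g).re) * Real.exp (κ * r * (su2Quat g).re)) := by
    intro r g
    rw [norm_profileField_sq p P Q hd' (r • su2Quat g), norm_smul, norm_su2Quat, mul_one, Real.norm_eq_abs, sq_abs,
      Quaternion.re_smul, smul_eq_mul, real_inner_smul_right]
    simp only [hc, he, hP, hQ, Finset.sum_range_succ, Finset.sum_range_zero, List.getD_cons_zero, List.getD_cons_succ, zero_add]
    ring
  have inner : ∀ r : ℝ, ∫ g, Real.exp (κ * r * (su2Quat g).re) * ‖profileField d' p P Q (r • su2Quat g)‖ ^ 2 ∂μ =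
      ∫ g, Real.exp (κ * r * (su2Quat g).re) *
          ((∑ k ∈ Finset.range 7, c k * (r * (su2Quat g).re) ^ k) + r ^ 2 * ∑ k ∈ Finset.range 7, e k * (r * (su2Quat g).re) ^ k) ∂μ := by
    intro r
    simp_rw [hpt r]
    have hQc : Continuous fun t : ℝ => Q t := by
      have : Q = fun t => q₀ + q₁ * t + q₂ * t ^ 2 + q₃ * t ^ 3 := funext hQ
      rw [this]; fun_prop
    have i1 : Integrable (fun g : Matrix.specialUnitaryGroup (Fin 2) ℂ => Real.exp (κ * r * (su2Quat g).re) *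
        ((∑ k ∈ Finset.range 7, c k * (r * (su2Quat g).re) ^ k) + r ^ 2 * ∑ k ∈ Finset.range 7, e k * (r * (su2Quat g).re) ^ k)) μ :=
      integrable_of_continuous_SUN (by fun_prop) μ
    have i2 : Integrable (fun g : Matrix.specialUnitaryGroup (Fin 2) ℂ =>
        ⟪d', su2Quat g⟫ * (2 * p * r * Q (r * (su2Quat g).re) * Real.exp (κ * r * (su2Quat g).re))) μ :=
      integrable_of_continuous_SUN ((continuous_const.inner hq1).mul (by fun_prop)) μ
    rw [integral_add i1 i2, integral_inner_mul_eq_zero hd' (fun t => 2 * p * r * Q (r * t) * Real.exp (κ * r * t)), add_zero]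
  have hL : (∫ r in (0:ℝ)..1, r ^ 3 * ∫ g, Real.exp (κ * r * (su2Quat g).re) * ‖profileField d' p P Q (r • su2Quat g)‖ ^ 2 ∂μ) =
      ∫ r in (0:ℝ)..1, r ^ 3 * ∫ g, Real.exp (κ * r * (su2Quat g).re) *
          ((∑ k ∈ Finset.range 7, c k * (r * (su2Quat g).re) ^ k) + r ^ 2 * ∑ k ∈ Finset.range 7, e k * (r * (su2Quat g).re) ^ k) ∂μ :=
    intervalIntegral.integral_congr fun r _ => by rw [inner r]
  rw [hL, key]
  simp only [hc, he, Finset.sum_range_succ, Finset.sum_range_zero, List.getD_cons_zero, List.getD_cons_succ, zero_add,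
    pow_zero, pow_one, one_mul, Nat.add_zero]
  ring

end Summit.Ventures.YMGap.PolyFluxMoments
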